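import Summits.Ventures.Crystal3D.Theorems.StickyWulffConstantTextureBuildWallCellOfPlates
import Summits.Ventures.Crystal3D.Theorems.StickyWulffConstantTextureLiminfTexShadowScaleBand
import HarnessLib

/-!
# TB-1 brick: SLAB PLATES — choosing the plate slab of a wall cell by pigeonhole so that its collar defects are few, and reading a healed slab as a complete plate
# (lane T, crux `TextureLiminfV5`, stmt-Ventures-23912; memo HOME/wulff-p2/g25/SLAB-PLATES-g25.md §3)

HONEST FRAMING. Venture `Summits/Ventures/Crystal3D` (cell `crystal3d-full`), route `route-Ventures-StickyWulffConstant`, helper `--supports` the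
law-v5 crux `TextureLiminfV5` (stmt-Ventures-23912).  Pure finite combinatorics + frame bookkeeping (census-free, standard axioms).  No cover is built;
F-C1 not moved.

WHY.  The wall cells of the healed `stub_TB_cover` ('…WallCellOfPlates': `PlacedCell.ofComplete`) need two COMPLETE plate slabs (model heights `[−2R₀, −R₀]`
and `[h + R₀, h + 2R₀]`, any gap `h ≥ 0`).  The constructor makes them complete by the site surgery (`exists_site_heal_family`, every site of the window is a
ball afterwards) and pays, by '…TextureBuildHealCollar', `6` per DEFECT IN THE 3-COLLAR of the window (vacant sites / off-lattice balls of the ORIGINAL packing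
near the slab boundary).  Where to put the slab is free: among `m` candidate slabs stacked along the cell normal, one has at most `1/m` of the column's
defects in its collar band.  This file is that selection and the frame glue:

* `exists_band_filter_card_le` — PIGEONHOLE: for a finite `D`, a height function `φ`, thickness `t ≥ 0` and `m ≥ 1` candidate slabs at heights
  `aₖ = a₀ + k(t + 7)`, some `k < m` has `m·#{d ∈ D : φ d ∈ [aₖ − 3, aₖ + t + 3]} ≤ #D` (the bands are pairwise disjoint; `exists_band_card_le`);
* `band_of_near_window` — for a `1`-Lipschitz `φ`, a point within `< r` of the window `{w ∈ P : φ w ∈ [a, a + t]}` has `φ ∈ (a − r, a + t + r)`;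
* **`exists_slab_window`** — THE SELECTION: given the column's site set `P`, a `1`-Lipschitz height `φ` and a finite `Dfx` containing every vacant `S`-site and
  every off-`S` ball within `< 3` of `P`, some candidate slab `W = {w ∈ P : φ w ∈ [aₖ, aₖ + t]}` has ONE finite set `B` (its band of `Dfx`) serving as both
  collar sets of `exists_site_heal_collar` (`hB`, `hJ` verbatim) with `m·#B ≤ #Dfx`;
* `abs_sub_coord_le_dist`, `lipschitz_modelHeight` — the model height `w ↦ (M⁻¹(w − t)) 2` of a placement `p ↦ M p + t` is `1`-Lipschitz;
* `mem_pullback_iff`, `rigid_mem_stacking_iff` — `p ∈ pullback X' M t ↔ M p + t ∈ X'`; a rigid motion carries `stacking L s σ` onto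
  `stacking (L.trans M) (M s + t) σ`;
* **`plate_hc_of_window`** — if the pushed-forward model plate sites lie in a window `W` all of whose sites are balls of `x'`, the hypothesis `hc₁`/`hc₂` of
  `PlacedCell.ofComplete` holds for the pulled-back configuration: the healed slab IS a complete plate.
-/

noncomputable section

namespace Summit.Ventures.Crystal3D.Theorems

open Finset Summit.Ventures.Crystal3D
open Literature.MathematicalPhysics.StatisticalMechanics (IsHaggSeq)
open Summit.Ventures.Crystal3D.Cruxes.TextureLiminf.TexShadow (E3 stacking rigid pullback rigid_symm_apply rigid_injective)

/-! ## Pigeonhole over candidate slabs -/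

section Pigeonhole

/-- **PIGEONHOLE OVER SLABS.**  Candidate slabs `k < m` at heights `aₖ := a₀ + k·(t + 7)`; the collar bands `[aₖ − 3, aₖ + t + 3]` are pairwise disjoint, so
one of them holds at most `#D / m` of the points of `D`. -/
theorem exists_band_filter_card_le (D : Finset E3) (φ : E3 → ℝ) (a₀ t : ℝ) (ht : 0 ≤ t) {m : ℕ} (hm : 0 < m) :
    ∃ k : ℕ, k < m ∧ (m : ℝ) * ((D.filter fun d => a₀ + k * (t + 7) - 3 ≤ φ d ∧ φ d ≤ a₀ + k * (t + 7) + t + 3).card : ℝ) ≤ D.card := by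
  classical
  set A : ℕ → Finset E3 := fun k => D.filter fun d => a₀ + k * (t + 7) - 3 ≤ φ d ∧ φ d ≤ a₀ + k * (t + 7) + t + 3 with hA
  have hs : (Finset.range m).Nonempty := ⟨0, Finset.mem_range.2 hm⟩
  have hsub : ∀ k ∈ Finset.range m, A k ⊆ D := fun k _ => Finset.filter_subset _ _
  have hdisj : ((Finset.range m : Finset ℕ) : Set ℕ).PairwiseDisjoint A := by
    intro k _ k' _ hkk'
    rw [Function.onFun, Finset.disjoint_left]
    intro d hd hd'
    obtain ⟨-, h1, h2⟩ := Finset.mem_filter.1 hd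
    obtain ⟨-, h1', h2'⟩ := Finset.mem_filter.1 hd'
    rcases lt_or_gt_of_ne hkk' with hlt | hlt
    · have hk : (k : ℝ) + 1 ≤ (k' : ℝ) := by exact_mod_cast hlt
      nlinarith
    · have hk : (k' : ℝ) + 1 ≤ (k : ℝ) := by exact_mod_cast hlt
      nlinarith
  obtain ⟨k, hk, hle⟩ := exists_band_card_le (Finset.range m) hs D A hsub hdisj
  refine ⟨k, Finset.mem_range.1 hk, ?_⟩
  rw [Finset.card_range] at hle
  have hmpos : (0 : ℝ) < m := by exact_mod_cast hm
  have := (le_div_iff₀ hmpos).1 hle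
  linarith

/-- For a `1`-Lipschitz height `φ`, a point within `< r` of the window `{w ∈ P : a ≤ φ w ≤ a + t}` has height in `(a − r, a + t + r)`. -/
theorem band_of_near_window {φ : E3 → ℝ} (hφ : ∀ p q : E3, |φ p - φ q| ≤ dist p q) (P : Finset E3) (a t r : ℝ) {w : E3}
    (hw : ∃ w₀ ∈ P.filter (fun w => a ≤ φ w ∧ φ w ≤ a + t), dist w w₀ < r) : a - r < φ w ∧ φ w < a + t + r := by
  obtain ⟨w₀, hw₀, hd⟩ := hw
  obtain ⟨-, h1, h2⟩ := Finset.mem_filter.1 hw₀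
  have h := hφ w w₀
  rw [abs_le] at h
  constructor <;> linarith

variable {N : ℕ}

open scoped Classical in
/-- **THE SLAB SELECTION.**  `P` = the column's sites, `φ` a `1`-Lipschitz height, `t ≥ 0` the slab thickness, `m ≥ 1` candidates at heights `a₀ + k(t + 7)`;
`Dfx` any finite set containing every vacant `S`-site and every off-`S` ball of `x` within `< 3` of `P`.  Then some candidate window
`W = {w ∈ P : φ w ∈ [aₖ, aₖ + t]}` admits ONE finite `B` satisfying both collar hypotheses of `exists_site_heal_collar` with `m·#B ≤ #Dfx`. -/
theorem exists_slab_window (x : Fin N → E3) (S : Set E3) (P Dfx : Finset E3) {φ : E3 → ℝ} (hφ : ∀ p q : E3, |φ p - φ q| ≤ dist p q)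
    (a₀ t : ℝ) (ht : 0 ≤ t) {m : ℕ} (hm : 0 < m)
    (hDv : ∀ w, w ∈ S → w ∉ Set.range x → (∃ p ∈ P, dist w p < 3) → w ∈ Dfx)
    (hDb : ∀ b, b ∈ Set.range x → b ∉ S → (∃ p ∈ P, dist b p < 3) → b ∈ Dfx) :
    ∃ (k : ℕ) (B : Finset E3), k < m ∧ (m : ℝ) * (B.card : ℝ) ≤ Dfx.card ∧
      (∀ w, w ∈ S → w ∉ P.filter (fun w => a₀ + k * (t + 7) ≤ φ w ∧ φ w ≤ a₀ + k * (t + 7) + t) → w ∉ Set.range x →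
        (∃ w₀ ∈ P.filter (fun w => a₀ + k * (t + 7) ≤ φ w ∧ φ w ≤ a₀ + k * (t + 7) + t), dist w w₀ < 3) → w ∈ B) ∧
      (∀ b, b ∈ Set.range x → b ∉ S → (∀ w ∈ P.filter (fun w => a₀ + k * (t + 7) ≤ φ w ∧ φ w ≤ a₀ + k * (t + 7) + t), 1 ≤ dist b w) →
        (∃ w₀ ∈ P.filter (fun w => a₀ + k * (t + 7) ≤ φ w ∧ φ w ≤ a₀ + k * (t + 7) + t), dist b w₀ < 2) → b ∈ B) := by
  classical
  obtain ⟨k, hk, hle⟩ := exists_band_filter_card_le Dfx φ a₀ t ht hm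
  refine ⟨k, Dfx.filter fun d => a₀ + k * (t + 7) - 3 ≤ φ d ∧ φ d ≤ a₀ + k * (t + 7) + t + 3, hk, hle, ?_, ?_⟩
  · intro w hwS _ hwx hnear
    have hP : ∃ p ∈ P, dist w p < 3 := by
      obtain ⟨w₀, hw₀, hd⟩ := hnear
      exact ⟨w₀, (Finset.mem_filter.1 hw₀).1, hd⟩
    have hband := band_of_near_window hφ P (a₀ + k * (t + 7)) t 3 hnear
    exact Finset.mem_filter.2 ⟨hDv w hwS hwx hP, by linarith [hband.1], by linarith [hband.2]⟩
  · intro b hbx hbS _ hnear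
    have hP : ∃ p ∈ P, dist b p < 3 := by
      obtain ⟨w₀, hw₀, hd⟩ := hnear
      exact ⟨w₀, (Finset.mem_filter.1 hw₀).1, by linarith⟩
    have hband := band_of_near_window hφ P (a₀ + k * (t + 7)) t 2 hnear
    exact Finset.mem_filter.2 ⟨hDb b hbx hbS hP, by linarith [hband.1], by linarith [hband.2]⟩

end Pigeonhole

/-! ## The model height of a placement is `1`-Lipschitz -/

section Height

/-- A coordinate difference is bounded by the distance. -/
theorem abs_sub_coord_le_dist (p q : E3) (i : Fin 3) : |p i - q i| ≤ dist p q := by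
  rw [dist_eq_norm, EuclideanSpace.norm_eq]
  have hle : ‖(p - q) i‖ ^ 2 ≤ ∑ j, ‖(p - q) j‖ ^ 2 :=
    Finset.single_le_sum (f := fun j => ‖(p - q) j‖ ^ 2) (fun j _ => sq_nonneg _) (Finset.mem_univ i)
  have h := Real.sqrt_le_sqrt hle
  rw [Real.sqrt_sq (norm_nonneg _)] at h
  rw [show p i - q i = (p - q) i from rfl, ← Real.norm_eq_abs]
  exact h

/-- **The model height of the placement `p ↦ M p + t`** — `w ↦ (M⁻¹ (w − t)) 2` — is `1`-Lipschitz. -/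
theorem lipschitz_modelHeight (M : E3 ≃ₗᵢ[ℝ] E3) (t : E3) (p q : E3) :
    |(M.symm (p - t)) 2 - (M.symm (q - t)) 2| ≤ dist p q := by
  have h := abs_sub_coord_le_dist (M.symm (p - t)) (M.symm (q - t)) 2
  rwa [LinearIsometryEquiv.dist_map, dist_sub_right] at h

end Height

/-! ## Reading a healed slab as a complete plate -/

section Plate

variable (M : E3 ≃ₗᵢ[ℝ] E3) (t : E3)

/-- `p ∈ pullback X' M t ↔ M p + t ∈ X'`. -/
theorem mem_pullback_iff (X' : Finset E3) (p : E3) : p ∈ pullback X' M t ↔ rigid M t p ∈ X' := by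
  unfold pullback
  rw [Finset.mem_image]
  constructor
  · rintro ⟨q, hq, rfl⟩
    rw [rigid_symm_apply]
    exact hq
  · intro hp
    refine ⟨rigid M t p, hp, ?_⟩
    show M.symm (M p + t - t) = p
    rw [add_sub_cancel_right, LinearIsometryEquiv.symm_apply_apply]

/-- A rigid motion carries a moved stacking onto a moved stacking: `M p + t ∈ stacking (L.trans M) (M s + t) σ ↔ p ∈ stacking L s σ`. -/
theorem rigid_mem_stacking_iff (L : E3 ≃ₗᵢ[ℝ] E3) (s : E3) (σ : ℤ → ℤ) (p : E3) :
    rigid M t p ∈ stacking (L.trans M) (M s + t) σ ↔ p ∈ stacking L s σ := by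
  unfold stacking
  constructor
  · rintro ⟨r, hr, hrp⟩
    refine ⟨r, hr, rigid_injective M t ?_⟩
    rw [← hrp]
    show M (L r + s) + t = (L.trans M) r + (M s + t)
    rw [LinearIsometryEquiv.trans_apply, map_add, add_assoc]
  · rintro ⟨r, hr, rfl⟩
    refine ⟨r, hr, ?_⟩
    show (L.trans M) r + (M s + t) = M (L r + s) + t
    rw [LinearIsometryEquiv.trans_apply, map_add, add_assoc]

/-- The image of a moved stacking under a rigid motion, as a set. -/
theorem rigid_image_stacking (L : E3 ≃ₗᵢ[ℝ] E3) (s : E3) (σ : ℤ → ℤ) :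
    rigid M t '' stacking L s σ = stacking (L.trans M) (M s + t) σ := by
  ext w
  constructor
  · rintro ⟨p, hp, rfl⟩
    exact (rigid_mem_stacking_iff M t L s σ p).2 hp
  · intro hw
    refine ⟨M.symm (w - t), ?_, rigid_symm_apply M t w⟩
    rw [← rigid_mem_stacking_iff M t L s σ, rigid_symm_apply]
    exact hw

variable {N' : ℕ}

/-- **A HEALED SLAB IS A COMPLETE PLATE.**  If every model plate site (model stacking `stacking L₁ s₁ σ₁`, heights `[lo, hi]`, radius `ρ`) is carried by the
placement into a window `W` all of whose sites are balls of `x'`, then the plate hypothesis of `PlacedCell.ofComplete` holds for the pulled-back configuration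
`pullback (image x') M t`. -/
theorem plate_hc_of_window (x' : Fin N' → E3) (L₁ : E3 ≃ₗᵢ[ℝ] E3) (s₁ : E3) (σ₁ : ℤ → ℤ) (lo hi ρ : ℝ) (W : Finset E3)
    (hWocc : ∀ w ∈ W, w ∈ Set.range x')
    (hW : ∀ p ∈ stacking L₁ s₁ σ₁, lo ≤ p 2 → p 2 ≤ hi → p 0 ^ 2 + p 1 ^ 2 ≤ ρ ^ 2 → rigid M t p ∈ W) :
    ∀ p ∈ stacking L₁ s₁ σ₁, lo ≤ p 2 → p 2 ≤ hi → p 0 ^ 2 + p 1 ^ 2 ≤ ρ ^ 2 → p ∈ pullback (Finset.univ.image x') M t := by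
  classical
  intro p hp h1 h2 h3
  rw [mem_pullback_iff]
  exact mem_image_univ_iff_mem_range.2 (hWocc _ (hW p hp h1 h2 h3))

/-- **The window that serves a plate**, actual-space form: the sites `w` of the ACTUAL stacking `stacking (L₁.trans M) (M s₁ + t) σ₁` whose model height
`(M⁻¹(w − t)) 2` lies in `[lo, hi]` and whose model radius is `≤ ρ` are exactly the pushed-forward model plate sites — so a window containing them (e.g. the
selected slab of `exists_slab_window` with `φ` the model height) serves `plate_hc_of_window`. -/
theorem rigid_mem_window_of_model (L₁ : E3 ≃ₗᵢ[ℝ] E3) (s₁ : E3) (σ₁ : ℤ → ℤ) (lo hi ρ : ℝ) (W : Finset E3)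
    (hW : ∀ w ∈ stacking (L₁.trans M) (M s₁ + t) σ₁, lo ≤ (M.symm (w - t)) 2 → (M.symm (w - t)) 2 ≤ hi →
      (M.symm (w - t)) 0 ^ 2 + (M.symm (w - t)) 1 ^ 2 ≤ ρ ^ 2 → w ∈ W) :
    ∀ p ∈ stacking L₁ s₁ σ₁, lo ≤ p 2 → p 2 ≤ hi → p 0 ^ 2 + p 1 ^ 2 ≤ ρ ^ 2 → rigid M t p ∈ W := by
  intro p hp h1 h2 h3
  have hsymm : M.symm (rigid M t p - t) = p := by
    show M.symm (M p + t - t) = p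
    rw [add_sub_cancel_right, LinearIsometryEquiv.symm_apply_apply]
  refine hW _ ((rigid_mem_stacking_iff M t L₁ s₁ σ₁ p).2 hp) ?_ ?_ ?_
  · rw [hsymm]; exact h1
  · rw [hsymm]; exact h2
  · rw [hsymm]; exact h3

end Plate

end Summit.Ventures.Crystal3D.Theorems

end
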